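import Mathlib
import Literature.Analysis.ODE.CodeListMeanValueExtension
import Summits.Ventures.FusionMHD.Models.CerfonFreidbergIterLikeAxis
import HarnessLib

/-!
# Ventures/FusionMHD — Models/CerfonFreidbergIterLikeMidplane.lean: the flux of record of the Cerfon–Freidberg ITER-like instance is
# STRICTLY CONVEX along the plasma midplane chord, so its magnetic axis is THE UNIQUE midplane critical point (kernel; interval range
# certificates, no new Krawczyk)

HONEST FRAMING (LADDER-GRIDFUSION three columns; rung F1.a(a) on the CF rung, qualitative companion of S2 #34 «F1.CF-AXIS-ITER»).
`Models/CerfonFreidbergIterLikeAxis.lean` (p505941) proved that `(X_a, 0)`, `X_a ∈ [1.04543964, 1.04543965]`, is a critical point of THE flux function of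
record `U` with `U_XX, U_YY > 0` there.  THIS FILE adds the GLOBAL midplane statement: on the whole plasma midplane chord
`17/25 ≤ X ≤ 33/25` (between the two printed boundary points `(1 ± ε, 0)` where `U = 0`) the radial curvature is positive,
`U_XX(X, 0) ≥ 1/20 > 0` — certified by FOUR natural-interval-extension range certificates (tree
`Literature/Analysis/ODE/CodeListMeanValueExtension.lean`: `evalBoxLE`, soundness `eval_mem_of_evalBoxLE`, Moore 1966 Thm 3.1) of the code list of
`U_XX(X, 0; c)` over «(#34's kernel coefficient box) × (X-sub-interval)» for the sub-intervals [17/25, 19/25], [19/25, 22/25], [22/25, 26/25], [26/25, 33/25]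
(each `decide +kernel`, seconds) — hence (`strictMonoOn_dR_midplane`) `X ↦ U_X(X, 0)` is strictly increasing on the chord and (`midplane_criticalPoint_unique`)
**`X_a` is the ONLY zero of `U_X(·, 0)` on `[17/25, 33/25]`**: the O-point of #34 is THE magnetic axis of the midplane chord, not merely a critical point;
`U_X < 0` to its left and `> 0` to its right (`dR_neg_of_lt_Xa` / `dR_pos_of_Xa_lt`), so `U(·, 0)` strictly decreases to the axis and increases after it.
CERTIFIED (kernel): as stated.  MODELLED: analytic CF family (ideal MHD, Solov'ev profiles, fixed analytic boundary); a statement about the model flux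
function on one chord — nothing about other critical points off the midplane, nothing about stability.  Typer/prover: gridfusion-model-5 (g5), 2026-08-27.
Citations: Freidberg 2014 §6.6.1 (6.151)–(6.155), (6.41) [Freidberg2014]; Moore 1966 Thm 3.1 / Moore 1979 §4.3 [Moore1979].
-/

noncomputable section

open Set NonemptyInterval Matrix
open Literature.Analysis.ODE Literature.Analysis.ODE.FExpr
open Literature.Analysis.ValidatedNumerics Literature.Analysis.ValidatedNumerics.ITaylor
open Literature.MathematicalPhysics.MHD Literature.MathematicalPhysics.MHD.GradShafranov
  Literature.MathematicalPhysics.MHD.CerfonFreidberg _root_.Real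

namespace Summit.Ventures.FusionMHD.Models.CFIterLike

/-! ## §1 The code list of `U_XX(X, 0; c)` and the four range certificates -/

/-- The code list of the midplane radial curvature `U_XX(X, 0)` of `U = cfSolution 0 c` (α = 0): unknowns `x₀…x₆ = c₀…c₆`, `x₇ = X`;
Horner form in `X²` of the closed form `dRR_cfSolution_zero` at `Y = 0` (one logarithm).  MODELLED: analytic CF family. -/
def uxxExpr : FExpr 8 :=
  add (add (add (smul 2 (var 1)) (smul (-3) (var 2))) (mul (pow (var 7) 2) (add (add (add (const (3 / 2)) (smul 12 (var 3))) (smul 21 (var 4))) (mul (pow (var 7) 2) (add (smul 30 (var 5)) (smul (-165) (var 6))))))) (mul (log (var 7)) (add (smul (-2) (var 2)) (mul (pow (var 7) 2) (add (smul 36 (var 4)) (mul (pow (var 7) 2) (smul (-450) (var 6)))))))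

/-- The four `X`-sub-intervals covering the plasma midplane chord `[1 − ε, 1 + ε] = [17/25, 33/25]`. -/
def chordPiece : Fin 4 → Iv :=
  ![⟨((17 / 25), (19 / 25)), by decide +kernel⟩, ⟨((19 / 25), (22 / 25)), by decide +kernel⟩,
    ⟨((22 / 25), (26 / 25)), by decide +kernel⟩, ⟨((26 / 25), (33 / 25)), by decide +kernel⟩]

/-- The box «coefficient box of #34 (coordinates 0–6 of `axKrawczyk.box`) × chord piece `j`». -/
def midBox (j : Fin 4) : Fin 8 → Iv :=
  fun i => if h : (i : ℕ) < 7 then axKrawczyk.box ⟨i, by omega⟩ else chordPiece j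

/-- The endpoints of the four chord pieces (decided). -/
theorem chordPiece_eq : ((chordPiece 0).fst = 17 / 25 ∧ (chordPiece 0).snd = 19 / 25)
    ∧ ((chordPiece 1).fst = 19 / 25 ∧ (chordPiece 1).snd = 22 / 25)
    ∧ ((chordPiece 2).fst = 22 / 25 ∧ (chordPiece 2).snd = 26 / 25)
    ∧ ((chordPiece 3).fst = 26 / 25 ∧ (chordPiece 3).snd = 33 / 25) := by
  decide +kernel

/-- **THE FOUR RANGE CERTIFICATES:** on every piece the natural interval extension of `U_XX(X, 0; c)` lies in `[1/20, 2]`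
(seeds ⟨64, 60, 56, 4, 0⟩). -/
theorem uxx_range_cert : ∀ j : Fin 4, evalBoxLE ⟨64, 60, 56, 4, 0⟩ uxxExpr (midBox j) ⟨((1 / 20), 2), by decide +kernel⟩ = true := by
  decide +kernel

/-! ## §2 Bridge and membership -/

/-- The coefficient vector carried by a point of the 8-space. -/
def midCoeffs (y : Fin 8 → ℝ) : Fin 7 → ℝ := ![y 0, y 1, y 2, y 3, y 4, y 5, y 6]

/-- `⟦uxxExpr⟧(y) = U_XX(y₇, 0)` for `U = cfSolution 0 (midCoeffs y)` (`y₇ ≠ 0`). -/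
theorem eval_uxxExpr (y : Fin 8 → ℝ) (hX : y 7 ≠ 0) : uxxExpr.eval y = dRR (cfSolution 0 (midCoeffs y)) (y 7) 0 := by
  rw [dRR_cfSolution_zero _ hX]
  simp [uxxExpr, FExpr.eval, midCoeffs, radP₂, radP₄, radP₆, radQ₂, radQ₄, radQ₆]
  ring

/-- The point `(coeff, X)` of the 8-space (coordinates 0–6 = `axZero`'s, i.e. `coeff`; coordinate 7 = `X`). -/
def midPoint (X : ℝ) : Fin 8 → ℝ :=
  fun i => if h : (i : ℕ) < 7 then axZero ⟨i, by omega⟩ else X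

/-- Its coefficient part is `coeff`. -/
theorem midCoeffs_midPoint (X : ℝ) : midCoeffs (midPoint X) = coeff := by
  funext k
  fin_cases k <;> simp [midCoeffs, midPoint, coeff, axCoeffs, coeffs, axProj]

/-- Its last coordinate is `X`. -/
theorem midPoint_seven (X : ℝ) : midPoint X 7 = X := by
  simp [midPoint]

/-- For `X` in piece `j`, the point `(coeff, X)` lies in `midBox j`. -/
theorem midPoint_mem {j : Fin 4} {X : ℝ} (hlo : ((chordPiece j).fst : ℝ) ≤ X) (hhi : X ≤ ((chordPiece j).snd : ℝ)) :
    midPoint X ∈ boxSet (castBox (midBox j)) := by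
  have hz := mem_boxSet_iff.mp axZero_mem
  rw [mem_boxSet_iff]
  intro i
  rw [castBox_apply, mem_ratCast_iff]
  by_cases hi : (i : ℕ) < 7
  · have h := hz ⟨i, by omega⟩
    rw [castBox_apply, mem_ratCast_iff] at h
    simp only [midBox, midPoint, hi, dif_pos]
    exact h
  · simp only [midBox, midPoint, hi, dif_neg, not_false_eq_true]
    exact ⟨hlo, hhi⟩

/-! ## §3 Positivity of `U_XX` on the chord, strict monotonicity of `U_X`, uniqueness of the axis -/

/-- **`U_XX(X, 0) ≥ 1/20 > 0` on the whole plasma midplane chord `17/25 ≤ X ≤ 33/25`.** -/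
theorem dRR_midplane_pos {X : ℝ} (h1 : (17 : ℝ) / 25 ≤ X) (h2 : X ≤ 33 / 25) : 1 / 20 ≤ dRR U X 0 := by
  have hX : X ≠ 0 := by intro h; rw [h] at h1; norm_num at h1
  have key : ∀ j : Fin 4, ((chordPiece j).fst : ℝ) ≤ X → X ≤ ((chordPiece j).snd : ℝ) → 1 / 20 ≤ dRR U X 0 := by
    intro j hlo hhi
    have hmem := midPoint_mem hlo hhi
    have h := eval_mem_of_evalBoxLE (uxx_range_cert j) hmem
    rw [mem_ratCast_iff] at h
    have hev : uxxExpr.eval (midPoint X) = dRR U X 0 := by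
      have h7 : midPoint X 7 ≠ 0 := by rw [midPoint_seven]; exact hX
      rw [eval_uxxExpr _ h7, midCoeffs_midPoint, midPoint_seven]; rfl
    rw [hev] at h
    have : (((1 : ℚ) / 20 : ℚ) : ℝ) = 1 / 20 := by push_cast; ring
    linarith [h.1]
  obtain ⟨⟨a1, a2⟩, ⟨b1, b2⟩, ⟨c1, c2⟩, ⟨d1, d2⟩⟩ := chordPiece_eq
  by_cases ha : X ≤ 19 / 25
  · exact key 0 (by rw [a1]; push_cast; linarith) (by rw [a2]; push_cast; linarith)
  by_cases hb : X ≤ 22 / 25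
  · exact key 1 (by rw [b1]; push_cast; linarith) (by rw [b2]; push_cast; linarith)
  by_cases hc : X ≤ 26 / 25
  · exact key 2 (by rw [c1]; push_cast; linarith) (by rw [c2]; push_cast; linarith)
  · exact key 3 (by rw [d1]; push_cast; linarith) (by rw [d2]; push_cast; linarith)

/-- `U_XX = d/dX U_X` as functions of the radial variable (definitions `dRR = iteratedDeriv 2`, `dR = deriv`). -/
theorem dRR_eq_deriv_dR (ψ : ℝ → ℝ → ℝ) (X Z : ℝ) : dRR ψ X Z = deriv (fun r => dR ψ r Z) X := by
  unfold dRR dR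
  rw [show (2 : ℕ) = 1 + 1 from rfl, iteratedDeriv_succ, iteratedDeriv_one]

/-- On the chord `X ↦ U_X(X, 0)` is differentiable with derivative `U_XX(X, 0) > 0` (a positive `deriv` forces differentiability). -/
theorem hasDerivAt_dR_midplane {X : ℝ} (h1 : (17 : ℝ) / 25 ≤ X) (h2 : X ≤ 33 / 25) :
    HasDerivAt (fun r => dR U r 0) (dRR U X 0) X := by
  have hpos := dRR_midplane_pos h1 h2
  rw [dRR_eq_deriv_dR] at hpos ⊢
  have hd : DifferentiableAt ℝ (fun r => dR U r 0) X := differentiableAt_of_deriv_ne_zero (by linarith)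
  exact hd.hasDerivAt

/-- **`X ↦ U_X(X, 0)` is strictly increasing on the plasma midplane chord.** -/
theorem strictMonoOn_dR_midplane : StrictMonoOn (fun r => dR U r 0) (Icc (17 / 25) (33 / 25)) := by
  apply strictMonoOn_of_deriv_pos (convex_Icc _ _)
  · intro x hx
    exact (hasDerivAt_dR_midplane hx.1 hx.2).continuousAt.continuousWithinAt
  · intro x hx
    rw [interior_Icc] at hx
    rw [← dRR_eq_deriv_dR]
    linarith [dRR_midplane_pos hx.1.le hx.2.le]

/-- `X_a` lies inside the chord. -/
theorem Xa_mem_chord : Xa ∈ Icc (17 / 25 : ℝ) (33 / 25) := by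
  constructor <;> linarith [Xa_bounds.1, Xa_bounds.2]

/-- **UNIQUENESS OF THE MIDPLANE AXIS:** the only zero of `U_X(·, 0)` on `[17/25, 33/25]` is `X_a`. -/
theorem midplane_criticalPoint_unique {X : ℝ} (hX : X ∈ Icc (17 / 25 : ℝ) (33 / 25)) (h0 : dR U X 0 = 0) : X = Xa := by
  have ha : dR U Xa 0 = 0 := axis.1
  by_contra hne
  rcases lt_or_gt_of_ne hne with hlt | hgt
  · have := strictMonoOn_dR_midplane hX Xa_mem_chord hlt
    simp only at this; linarith
  · have := strictMonoOn_dR_midplane Xa_mem_chord hX hgt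
    simp only at this; linarith

/-- `U_X(X, 0) < 0` on the chord to the LEFT of the axis … -/
theorem dR_neg_of_lt_Xa {X : ℝ} (hX : X ∈ Icc (17 / 25 : ℝ) (33 / 25)) (hlt : X < Xa) : dR U X 0 < 0 := by
  have := strictMonoOn_dR_midplane hX Xa_mem_chord hlt
  have ha : dR U Xa 0 = 0 := axis.1
  simp only at this; linarith

/-- … and `> 0` to the RIGHT of it. -/
theorem dR_pos_of_Xa_lt {X : ℝ} (hX : X ∈ Icc (17 / 25 : ℝ) (33 / 25)) (hgt : Xa < X) : 0 < dR U X 0 := by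
  have := strictMonoOn_dR_midplane Xa_mem_chord hX hgt
  have ha : dR U Xa 0 = 0 := axis.1
  simp only at this; linarith

/-- The midplane critical-point set of the chord is the singleton `{X_a}`. -/
theorem midplane_criticalSet_eq : {X ∈ Icc (17 / 25 : ℝ) (33 / 25) | dR U X 0 = 0} = {Xa} := by
  ext X
  simp only [mem_setOf_eq, mem_singleton_iff]
  constructor
  · rintro ⟨hX, h0⟩; exact midplane_criticalPoint_unique hX h0
  · rintro rfl; exact ⟨Xa_mem_chord, axis.1⟩

end Summit.Ventures.FusionMHD.Models.CFIterLike

/-! ## §4 The midplane flux profile itself: negative inside the chord, strict global minimum at the axis (appended 2026-08-27, model-5 g5) -/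

namespace Summit.Ventures.FusionMHD.Models.CFIterLike

open Set Literature.MathematicalPhysics.MHD Literature.MathematicalPhysics.MHD.GradShafranov
  Literature.MathematicalPhysics.MHD.CerfonFreidberg _root_.Real

/-- The midplane slice `X ↦ U(X, 0)` is differentiable at every `X ≠ 0`, with derivative `U_X(X, 0)` (closed form
`P(X) + Q(X)·ln X`). -/
theorem hasDerivAt_U_midplane {X : ℝ} (hX : X ≠ 0) : HasDerivAt (fun r => U r 0) (dR U X 0) X := by
  have hd : DifferentiableAt ℝ (fun r => U r 0) X := by
    show DifferentiableAt ℝ (fun r => cfSolution 0 coeff r 0) X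
    rw [cfSolution_zero_radial coeff 0]
    have hl : DifferentiableAt ℝ Real.log X := Real.differentiableAt_log hX
    fun_prop
  exact hd.hasDerivAt

/-- `U(·, 0)` is continuous on the chord. -/
theorem continuousOn_U_midplane : ContinuousOn (fun r => U r 0) (Icc (17 / 25 : ℝ) (33 / 25)) := by
  intro x hx
  have hx0 : x ≠ 0 := by intro h; rw [h] at hx; norm_num at hx
  exact (hasDerivAt_U_midplane hx0).continuousAt.continuousWithinAt

/-- **`U(·, 0)` is strictly DECREASING on `[17/25, X_a]` …** (`U_X < 0` to the left of the axis). -/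
theorem strictAntiOn_U_left : StrictAntiOn (fun r => U r 0) (Icc (17 / 25 : ℝ) Xa) := by
  apply strictAntiOn_of_deriv_neg (convex_Icc _ _)
  · exact continuousOn_U_midplane.mono (Icc_subset_Icc_right Xa_mem_chord.2)
  · intro x hx
    rw [interior_Icc] at hx
    have hx0 : x ≠ 0 := by intro h; rw [h] at hx; norm_num at hx
    rw [(hasDerivAt_U_midplane hx0).deriv]
    exact dR_neg_of_lt_Xa ⟨hx.1.le, by linarith [hx.2, Xa_mem_chord.2]⟩ hx.2

/-- **… and strictly INCREASING on `[X_a, 33/25]`.** -/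
theorem strictMonoOn_U_right : StrictMonoOn (fun r => U r 0) (Icc Xa (33 / 25 : ℝ)) := by
  apply strictMonoOn_of_deriv_pos (convex_Icc _ _)
  · exact continuousOn_U_midplane.mono (Icc_subset_Icc_left Xa_mem_chord.1)
  · intro x hx
    rw [interior_Icc] at hx
    have hx0 : x ≠ 0 := by intro h; rw [h] at hx; linarith [hx.1, Xa_pos]
    rw [(hasDerivAt_U_midplane hx0).deriv]
    exact dR_pos_of_Xa_lt ⟨by linarith [hx.1, Xa_mem_chord.1], hx.2.le⟩ hx.1

/-- **The axis value is the STRICT GLOBAL MINIMUM of the midplane flux:** `U(X_a, 0) < U(X, 0)` for every other `X` of the chord. -/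
theorem U_axis_lt_of_ne {X : ℝ} (hX : X ∈ Icc (17 / 25 : ℝ) (33 / 25)) (hne : X ≠ Xa) : U Xa 0 < U X 0 := by
  rcases lt_or_gt_of_ne hne with hlt | hgt
  · have := strictAntiOn_U_left ⟨hX.1, hlt.le⟩ ⟨Xa_mem_chord.1, le_rfl⟩ hlt
    simpa using this
  · have := strictMonoOn_U_right ⟨le_rfl, Xa_mem_chord.2⟩ ⟨hgt.le, hX.2⟩ hgt
    simpa using this

/-- The flux vanishes at the two chord ends (they are the printed boundary points `(1 ± ε, 0)`). -/
theorem U_chord_ends : U (17 / 25) 0 = 0 ∧ U (33 / 25) 0 = 0 :=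
  ⟨(zero_at_constraint_points isInstance_U).2.1, (zero_at_constraint_points isInstance_U).1⟩

/-- **`U(X, 0) < 0` strictly inside the chord** — the open midplane chord `17/25 < X < 33/25` lies in the plasma `{U < 0}` of the model. -/
theorem U_midplane_neg {X : ℝ} (h1 : (17 : ℝ) / 25 < X) (h2 : X < 33 / 25) : U X 0 < 0 := by
  rcases le_or_gt X Xa with hle | hgt
  · -- left part: U decreasing from U(17/25) = 0
    have := strictAntiOn_U_left ⟨le_rfl, Xa_mem_chord.1⟩ ⟨h1.le, hle⟩ h1
    simp only at this
    linarith [U_chord_ends.1]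
  · -- right part: U increasing up to U(33/25) = 0
    have := strictMonoOn_U_right ⟨hgt.le, h2.le⟩ ⟨Xa_mem_chord.2, le_rfl⟩ h2
    simp only at this
    linarith [U_chord_ends.2]

/-- Hence `−0.03684606 ≤ U(X, 0) ≤ 0` on the whole closed chord (the axis bracket of `U_axis_bounds` is the floor). -/
theorem U_midplane_bounds {X : ℝ} (hX : X ∈ Icc (17 / 25 : ℝ) (33 / 25)) :
    (-3684606 / 100000000 : ℝ) ≤ U X 0 ∧ U X 0 ≤ 0 := by
  constructor
  · by_cases hne : X = Xa
    · rw [hne]; exact U_axis_bounds.1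
    · linarith [U_axis_lt_of_ne hX hne, U_axis_bounds.1]
  · rcases eq_or_lt_of_le hX.1 with h | h
    · rw [← h]; exact U_chord_ends.1.le
    rcases eq_or_lt_of_le hX.2 with h' | h'
    · rw [h']; exact U_chord_ends.2.le
    exact (U_midplane_neg h h').le

/-- On the midplane the vertical derivative vanishes identically (up–down symmetry), so a midplane point is a critical
point of `U` iff `U_X` vanishes there. -/
theorem isCriticalPoint_midplane_iff (X : ℝ) : IsCriticalPoint U X 0 ↔ dR U X 0 = 0 := by
  unfold IsCriticalPoint
  have hz : dZ U X 0 = 0 := dZ_cfSolution_zero_midplane coeff X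
  exact ⟨fun h => h.1, fun h => ⟨h, hz⟩⟩

/-- **THE magnetic axis of the chord:** the set of midplane critical points of the flux of record on `[17/25, 33/25]` is `{(X_a, 0)}`. -/
theorem midplane_isCriticalPoint_iff {X : ℝ} (hX : X ∈ Icc (17 / 25 : ℝ) (33 / 25)) : IsCriticalPoint U X 0 ↔ X = Xa := by
  rw [isCriticalPoint_midplane_iff]
  exact ⟨midplane_criticalPoint_unique hX, fun h => h ▸ axis.1⟩

end Summit.Ventures.FusionMHD.Models.CFIterLike
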